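import Summits.CriticalPhenomena.PercolationContinuityZ3.Theorems.Transplant.FKConnectivityAllQAntipodalRootCert
import HarnessLib

/-!
# Connectivity correlation inequalities for `φ_{w,q}`, every `q > 0` — file 78b: **QUARTER-SLICED CERTIFICATES (TWO ROOTS)**
# (the certificate of `C_∞⁺` for a cell with a mixed root pair `e ∈ S`, `e' ∈ M∖S` lives on the configurations avoiding both roots,
# with three extra generators: the two symmetrised down-moves and the KLEIN ORBITS)

Support file (`--supports stmt-CriticalPhenomena-4575`), FK sub-lane `prim-bschramm-fk-2` (gen 36); builds on p205010 (kernel theorem, internal audit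
signed; external expert review pending).  No definitions, no named facts, no sorries; standard axioms.

Continuation of 78a (`…AntipodalRootCert`, one root).  With two roots `e ∈ S`, `e' ∈ N = M∖S` the product `Φ = f̂ĝ` is odd under the `S`-flip
`τ_S`, odd under the `N`-flip `σ_N` (**`FK.hat_nflip_of_readOnly` / `FK.hat_nflip_of_notRead`**) and even under complementation in `M`
(**`FK.hat_prod_sdiff`**), so the levelwise antipodal sum over `γ ⊆ M` folds onto the QUARTER `δ ⊆ M'' = M∖{e,e'}`:
`Σ_{ℓ(γ)≤J} Φ(γ) = −2 Σ_{δ⊆M''} K_J(δ)Φ(δ)`, `K_J(δ) = 1{ℓ(τ_Sδ) ≤ J} − 1{ℓ(δ) ≤ J}`.  The folded images of the squares of 77a are four families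
of generators on the quarter — elementary squares, `S`-symmetrised down-moves in `N` (from `(e,n)`-squares), `N`-symmetrised down-moves in `S`
(from `(a,e')`-squares; **`FK.hat_prod_nflip_erase`**: `Φ(σ'δ) = −Φ(δ+e')`) and KLEIN ORBITS `δ_δ+δ_{τ'δ}+δ_{σ'δ}+δ_{M''∖δ}` (from the
`(e,e')`-square) — and a nonnegative combination of them equal to `K_J` (a QUARTER-SLICED CERTIFICATE) forces `Σ_{ℓ≤J} f̂ĝ ≤ 0`
(**`FK.levels_le_of_rootPairCert`**).  In the language of memo FROM-fk-2-g36 / FK-Q2 §45 this is the checker for the statements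
`(Q)`: `D^{G/st}_j + 1{ℓ=j, s≁t} ∈ Sq+SDY+SDX+KL⁺` (mixed PARALLEL root pair on the two-terminal network `G = M∖{e,e'}`) and `(Q*)` (mixed SERIES
root pair; same cone), to which `(ID)` for every 2-connected series–parallel host reduces; both hold with slack exactly 2 in every exact instance
through 7 edges (kit j274225: 232,792 LPs, `θ* ≥ 2`).
[cite: Grimmett2006, §1.4 eq. (1.20) (p. 15); §3.8 Thm. (3.90) (pp. 61–62)] [cite: Wagner2006, Thm. 5.8(d), §5.3]
-/

noncomputable section

namespace Summit.CriticalPhenomena.PercolationContinuityZ3.Theorems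

namespace FK

open SimpleGraph Literature.Probability.LatticeModels Literature.Probability.Percolation
open scoped Classical

variable {V : Type*}

/-! ### Flips of the `N`-part (`N = M ∖ S`) -/

/-- Under the `N`-flip `γ ↦ (N∖γ) ∪ (γ∖N)` (`N = M∖S`) the antipodal difference of a function READING ONLY `S` is unchanged. [folklore] -/
theorem hat_nflip_of_readOnly {f : Finset (Sym2 V) → ℝ} {M C S γ : Finset (Sym2 V)} (hS : S ⊆ M) (hγ : γ ⊆ M)
    (hf : ∀ e : Sym2 V, e ∉ S → ∀ A : Finset (Sym2 V), f (insert e A) = f A) :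
    f ((M \ S) \ γ ∪ γ \ (M \ S) ∪ C) - f (M \ ((M \ S) \ γ ∪ γ \ (M \ S)) ∪ C) = f (γ ∪ C) - f (M \ γ ∪ C) := by
  have e1 : f ((M \ S) \ γ ∪ γ \ (M \ S) ∪ C) = f (γ ∪ C) := by
    refine eq_of_readOnly_inter_eq hf ?_
    ext x
    have h1 : x ∈ S → x ∈ M := fun h => hS h
    have h2 : x ∈ γ → x ∈ M := fun h => hγ h
    simp only [Finset.mem_inter, Finset.mem_union, Finset.mem_sdiff]
    tauto
  have e2 : f (M \ ((M \ S) \ γ ∪ γ \ (M \ S)) ∪ C) = f (M \ γ ∪ C) := by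
    refine eq_of_readOnly_inter_eq hf ?_
    ext x
    have h1 : x ∈ S → x ∈ M := fun h => hS h
    have h2 : x ∈ γ → x ∈ M := fun h => hγ h
    simp only [Finset.mem_inter, Finset.mem_union, Finset.mem_sdiff]
    tauto
  rw [e1, e2]

/-- Under the `N`-flip the antipodal difference of a function NOT READING `S` changes sign. [folklore] -/
theorem hat_nflip_of_notRead {g : Finset (Sym2 V) → ℝ} {M C S γ : Finset (Sym2 V)} (hS : S ⊆ M) (hγ : γ ⊆ M)
    (hg : ∀ e ∈ S, ∀ A : Finset (Sym2 V), g (insert e A) = g A) :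
    g ((M \ S) \ γ ∪ γ \ (M \ S) ∪ C) - g (M \ ((M \ S) \ γ ∪ γ \ (M \ S)) ∪ C) = -(g (γ ∪ C) - g (M \ γ ∪ C)) := by
  have e1 : g ((M \ S) \ γ ∪ γ \ (M \ S) ∪ C) = g (M \ γ ∪ C) := by
    refine eq_of_notRead_sdiff_eq hg ?_
    ext x
    have h1 : x ∈ S → x ∈ M := fun h => hS h
    have h2 : x ∈ γ → x ∈ M := fun h => hγ h
    simp only [Finset.mem_sdiff, Finset.mem_union]
    tauto
  have e2 : g (M \ ((M \ S) \ γ ∪ γ \ (M \ S)) ∪ C) = g (γ ∪ C) := by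
    refine eq_of_notRead_sdiff_eq hg ?_
    ext x
    have h1 : x ∈ S → x ∈ M := fun h => hS h
    have h2 : x ∈ γ → x ∈ M := fun h => hγ h
    simp only [Finset.mem_sdiff, Finset.mem_union]
    tauto
  rw [e1, e2, neg_sub]

/-- The `S`-flip and the `N`-flip of a configuration of `M` are complementary inside `M`. [folklore] -/
theorem sdiff_nflip_eq_sflip {M S γ : Finset (Sym2 V)} (hS : S ⊆ M) (hγ : γ ⊆ M) :
    M \ ((M \ S) \ γ ∪ γ \ (M \ S)) = S \ γ ∪ γ \ S := by
  ext x
  have h1 : x ∈ S → x ∈ M := fun h => hS h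
  have h2 : x ∈ γ → x ∈ M := fun h => hγ h
  simp only [Finset.mem_sdiff, Finset.mem_union]
  tauto

/-- The `N`-flip has the same antipodal exponent as the `S`-flip (they are complementary). [cite: Grimmett2006, §1.4 eq. (1.20) (p. 15)] -/
theorem apExpC_nflip (M C S γ : Finset (Sym2 V)) (hS : S ⊆ M) (hγ : γ ⊆ M) :
    apExpC M C ((M \ S) \ γ ∪ γ \ (M \ S)) = apExpC M C (S \ γ ∪ γ \ S) := by
  rw [← apExpC_sdiff M C (sflip_subset Finset.sdiff_subset hγ), sdiff_nflip_eq_sflip hS hγ]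

/-- The product `f̂ĝ` is EVEN under complementation inside the cell. [folklore] -/
theorem hat_prod_sdiff (M C : Finset (Sym2 V)) (f g : Finset (Sym2 V) → ℝ) {γ : Finset (Sym2 V)} (hγ : γ ⊆ M) :
    (f (M \ γ ∪ C) - f (M \ (M \ γ) ∪ C)) * (g (M \ γ ∪ C) - g (M \ (M \ γ) ∪ C)) =
      (f (γ ∪ C) - f (M \ γ ∪ C)) * (g (γ ∪ C) - g (M \ γ ∪ C)) := by
  simp only [Finset.sdiff_sdiff_eq_self hγ]
  ring

/-- **Erase-flip identity for a root in `N`.**  For `e' ∈ M ∖ S`, `f` reading only `S`, `g` not reading `S` and `δ ⊆ M ∖ e'`: flipping the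
`(M∖S)∖e'`-part of `δ` changes `f̂ĝ` into minus its value at `δ + e'`. [folklore] -/
theorem hat_prod_nflip_erase (M C S : Finset (Sym2 V)) (f g : Finset (Sym2 V) → ℝ) (hS : S ⊆ M) {e' : Sym2 V} (he' : e' ∈ M \ S)
    (hf : ∀ a : Sym2 V, a ∉ S → ∀ A : Finset (Sym2 V), f (insert a A) = f A)
    (hg : ∀ a ∈ S, ∀ A : Finset (Sym2 V), g (insert a A) = g A)
    {δ : Finset (Sym2 V)} (hδ : δ ⊆ M.erase e') :
    (f ((M \ S).erase e' \ δ ∪ δ \ (M \ S).erase e' ∪ C) - f (M \ ((M \ S).erase e' \ δ ∪ δ \ (M \ S).erase e') ∪ C)) *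
        (g ((M \ S).erase e' \ δ ∪ δ \ (M \ S).erase e' ∪ C) - g (M \ ((M \ S).erase e' \ δ ∪ δ \ (M \ S).erase e') ∪ C)) =
      -((f (insert e' δ ∪ C) - f (M \ insert e' δ ∪ C)) * (g (insert e' δ ∪ C) - g (M \ insert e' δ ∪ C))) := by
  obtain ⟨hδM, heδ⟩ := subset_of_subset_erase hδ
  have he'M : e' ∈ M := (Finset.mem_sdiff.1 he').1
  have he'S : e' ∉ S := (Finset.mem_sdiff.1 he').2
  have h1 : ∀ x, x ∈ S → x ∈ M := fun x h => hS h
  have h2 : ∀ x, x ∈ δ → x ∈ M := fun x h => hδM h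
  have h3 : ∀ x, x ∈ δ → x ≠ e' := fun x h hx => heδ (hx ▸ h)
  have h4 : ∀ x, x = e' → x ∈ M := fun x h => h ▸ he'M
  have h5 : ∀ x, x = e' → x ∉ S := fun x h => h ▸ he'S
  have f1 : f ((M \ S).erase e' \ δ ∪ δ \ (M \ S).erase e' ∪ C) = f (insert e' δ ∪ C) := by
    refine eq_of_readOnly_inter_eq hf ?_
    ext x
    by_cases hx : x = e'
    · subst hx
      simp only [Finset.mem_inter, Finset.mem_union, Finset.mem_sdiff, Finset.mem_erase, Finset.mem_insert]
      grind
    · have := h1 x; have := h2 x; have := h3 x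
      simp only [Finset.mem_inter, Finset.mem_union, Finset.mem_sdiff, Finset.mem_erase, Finset.mem_insert, hx, ne_eq,
        not_false_eq_true, true_and, false_or]
      grind
  have f2 : f (M \ ((M \ S).erase e' \ δ ∪ δ \ (M \ S).erase e') ∪ C) = f (M \ insert e' δ ∪ C) := by
    refine eq_of_readOnly_inter_eq hf ?_
    ext x
    by_cases hx : x = e'
    · subst hx
      simp only [Finset.mem_inter, Finset.mem_union, Finset.mem_sdiff, Finset.mem_erase, Finset.mem_insert]
      grind
    · have := h1 x; have := h2 x; have := h3 x
      simp only [Finset.mem_inter, Finset.mem_union, Finset.mem_sdiff, Finset.mem_erase, Finset.mem_insert, hx, ne_eq,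
        not_false_eq_true, true_and, false_or]
      grind
  have g1 : g ((M \ S).erase e' \ δ ∪ δ \ (M \ S).erase e' ∪ C) = g (M \ insert e' δ ∪ C) := by
    refine eq_of_notRead_sdiff_eq hg ?_
    ext x
    by_cases hx : x = e'
    · subst hx
      simp only [Finset.mem_union, Finset.mem_sdiff, Finset.mem_erase, Finset.mem_insert]
      grind
    · have := h1 x; have := h2 x; have := h3 x
      simp only [Finset.mem_union, Finset.mem_sdiff, Finset.mem_erase, Finset.mem_insert, hx, ne_eq,
        not_false_eq_true, true_and, false_or]
      grind
  have g2 : g (M \ ((M \ S).erase e' \ δ ∪ δ \ (M \ S).erase e') ∪ C) = g (insert e' δ ∪ C) := by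
    refine eq_of_notRead_sdiff_eq hg ?_
    ext x
    by_cases hx : x = e'
    · subst hx
      simp only [Finset.mem_union, Finset.mem_sdiff, Finset.mem_erase, Finset.mem_insert]
      grind
    · have := h1 x; have := h2 x; have := h3 x
      simp only [Finset.mem_union, Finset.mem_sdiff, Finset.mem_erase, Finset.mem_insert, hx, ne_eq,
        not_false_eq_true, true_and, false_or]
      grind
  rw [f1, f2, g1, g2]
  ring

/-! ### Small set identities for two roots -/

/-- Inserting an element outside `T` commutes with the `T`-flip. [folklore] -/
theorem insert_tflip_of_notMem {T δ : Finset (Sym2 V)} {a : Sym2 V} (ha : a ∉ T) :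
    insert a (T \ δ ∪ δ \ T) = T \ insert a δ ∪ insert a δ \ T := by
  ext x
  by_cases hx : x = a
  · subst hx; simp [ha]
  · simp only [Finset.mem_insert, hx, false_or, Finset.mem_union, Finset.mem_sdiff]

/-- Removing both roots and complementing inside the doubly punctured cell. [folklore] -/
theorem sdiff_insert_insert_eq {M δ : Finset (Sym2 V)} {e e' : Sym2 V} :
    M \ insert e (insert e' δ) = ((M.erase e).erase e') \ δ := by
  ext x
  simp only [Finset.mem_sdiff, Finset.mem_insert, Finset.mem_erase]
  grind

/-- Re-inserting both roots into the complement inside the doubly punctured cell gives the complement in the cell. [folklore] -/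
theorem insert_insert_sdiff_eq {M δ : Finset (Sym2 V)} {e e' : Sym2 V} (he : e ∈ M) (he' : e' ∈ M)
    (hδ : δ ⊆ (M.erase e).erase e') : insert e (insert e' (((M.erase e).erase e') \ δ)) = M \ δ := by
  ext x
  have h1 : x ∈ δ → x ≠ e' ∧ x ≠ e ∧ x ∈ M := fun h => by simpa [Finset.mem_erase] using hδ h
  simp only [Finset.mem_insert, Finset.mem_sdiff, Finset.mem_erase]
  grind

/-! ### The quarter-sliced certificate (two roots: `e ∈ S`, `e' ∈ M ∖ S`) closes `C_∞⁺` -/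

/-- **Quarter-sliced certificates close `C_∞⁺` (two roots).**  Let `e ∈ S` and `e' ∈ M ∖ S` be two root edges and write
`M'' = M ∖ {e, e'}`, `τ'` for the flip of the `S∖e`-part, `σ'` for the flip of the `(M∖S)∖e'`-part of a configuration `δ ⊆ M''`.
Suppose the slice `K_J(δ) = 1{ℓ((S∖δ)∪(δ∖S)) ≤ J} − 1{ℓ(δ) ≤ J}` (`δ ⊆ M''`, `ℓ = apExpC M C`) is a nonnegative combination of
(i) elementary squares (`a ∈ S∖e`, `n ∈ (M∖S)∖e'`), (ii) `S`-symmetrised down-moves in `N` (`δ_δ + δ_{τ'δ} − δ_{δ+n} − δ_{τ'δ+n}`),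
(iii) `N`-symmetrised down-moves in `S` (`δ_δ + δ_{σ'δ} − δ_{δ+a} − δ_{σ'δ+a}`) and (iv) KLEIN ORBITS `δ_δ + δ_{τ'δ} + δ_{σ'δ} + δ_{M''∖δ}`
(weights `c, dY, dX, κ ≥ 0`; hypothesis `hcert` in functional form).  Then the levelwise antipodal inequality holds at level `J` for every
increasing `f` reading only `S` and every increasing `g` not reading `S`.  (On `Φ = f̂ĝ` the four generators evaluate to the `(a,n)`-, `(e,n)`-,
`(a,e')`- and `(e,e')`-squares of 77a; the four slices `δ, δ+e, δ+e', δ+e+e'` of the levelwise sum fold onto the quarter `δ ⊆ M''` by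
`Φ∘τ_S = −Φ`, `Φ∘σ_N = −Φ`, `Φ(M∖γ) = Φ(γ)`.)  This is the certificate form of `(ID)` for a host with a MIXED parallel root pair — the
re-routing step of memo FROM-fk-2-g35 §2.6 — and, verbatim, for a mixed series root pair (memo FROM-fk-2-g36).
[cite: Grimmett2006, §3.8 Thm. (3.90) (pp. 61–62); §3.9 (pp. 63–64)] [cite: Wagner2006, Thm. 5.8(d), §5.3] -/
theorem levels_le_of_rootPairCert (M C S : Finset (Sym2 V)) (hS : S ⊆ M) {e e' : Sym2 V} (he : e ∈ S) (he' : e' ∈ M \ S) (J : ℕ)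
    (c : Finset (Sym2 V) → Sym2 V → Sym2 V → ℝ) (hc : ∀ δ a n, 0 ≤ c δ a n)
    (dY : Finset (Sym2 V) → Sym2 V → ℝ) (hdY : ∀ δ n, 0 ≤ dY δ n)
    (dX : Finset (Sym2 V) → Sym2 V → ℝ) (hdX : ∀ δ a, 0 ≤ dX δ a)
    (κ : Finset (Sym2 V) → ℝ) (hκ : ∀ δ, 0 ≤ κ δ)
    (hcert : ∀ Φ : Finset (Sym2 V) → ℝ,
      ∑ δ ∈ ((M.erase e).erase e').powerset,
          ((if apExpC M C (S \ δ ∪ δ \ S) ≤ J then Φ δ else 0) - (if apExpC M C δ ≤ J then Φ δ else 0)) =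
        ∑ δ ∈ ((M.erase e).erase e').powerset,
          (∑ a ∈ S.erase e, ∑ n ∈ (M \ S).erase e',
              c δ a n * (Φ δ + Φ (insert a (insert n δ)) - Φ (insert a δ) - Φ (insert n δ)) +
            ∑ n ∈ (M \ S).erase e', dY δ n * (Φ δ + Φ (S.erase e \ δ ∪ δ \ S.erase e) - Φ (insert n δ) -
              Φ (insert n (S.erase e \ δ ∪ δ \ S.erase e))) +
            ∑ a ∈ S.erase e, dX δ a * (Φ δ + Φ ((M \ S).erase e' \ δ ∪ δ \ (M \ S).erase e') - Φ (insert a δ) -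
              Φ (insert a ((M \ S).erase e' \ δ ∪ δ \ (M \ S).erase e'))) +
            κ δ * (Φ δ + Φ (S.erase e \ δ ∪ δ \ S.erase e) + Φ ((M \ S).erase e' \ δ ∪ δ \ (M \ S).erase e') +
              Φ (((M.erase e).erase e') \ δ))))
    (f g : Finset (Sym2 V) → ℝ)
    (hf : ∀ a : Sym2 V, a ∉ S → ∀ A : Finset (Sym2 V), f (insert a A) = f A)
    (hg : ∀ a ∈ S, ∀ A : Finset (Sym2 V), g (insert a A) = g A)
    (hfm : ∀ ⦃A B : Finset (Sym2 V)⦄, A ⊆ B → f A ≤ f B) (hgm : ∀ ⦃A B : Finset (Sym2 V)⦄, A ⊆ B → g A ≤ g B) :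
    ∑ γ ∈ M.powerset with apExpC M C γ ≤ J, (f (γ ∪ C) - f (M \ γ ∪ C)) * (g (γ ∪ C) - g (M \ γ ∪ C)) ≤ 0 := by
  set Φ : Finset (Sym2 V) → ℝ := fun γ => (f (γ ∪ C) - f (M \ γ ∪ C)) * (g (γ ∪ C) - g (M \ γ ∪ C)) with hΦ
  -- bookkeeping
  have heM : e ∈ M := hS he
  have he'M : e' ∈ M := (Finset.mem_sdiff.1 he').1
  have he'S : e' ∉ S := (Finset.mem_sdiff.1 he').2
  have hee' : e' ≠ e := fun h => he'S (h ▸ he)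
  have heM' : e ∉ M.erase e := Finset.notMem_erase e M
  have he'Me : e' ∈ M.erase e := Finset.mem_erase.2 ⟨hee', he'M⟩
  have he'M'' : e' ∉ (M.erase e).erase e' := Finset.notMem_erase e' _
  have hS' : S.erase e ⊆ (M.erase e).erase e' := by
    intro x hx
    have hxS : x ∈ S := Finset.mem_of_mem_erase hx
    exact Finset.mem_erase.2 ⟨fun h => he'S (h ▸ hxS), Finset.mem_erase.2 ⟨(Finset.mem_erase.1 hx).1, hS hxS⟩⟩
  have hN' : (M \ S).erase e' ⊆ (M.erase e).erase e' := by
    intro x hx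
    have hxN : x ∈ M \ S := Finset.mem_of_mem_erase hx
    exact Finset.mem_erase.2 ⟨(Finset.mem_erase.1 hx).1,
      Finset.mem_erase.2 ⟨fun h => (Finset.mem_sdiff.1 hxN).2 (h ▸ he), (Finset.mem_sdiff.1 hxN).1⟩⟩
  have hsub : ∀ δ ∈ ((M.erase e).erase e').powerset, δ ⊆ M.erase e ∧ δ ⊆ M.erase e' ∧ δ ⊆ M ∧ e ∉ δ ∧ e' ∉ δ := by
    intro δ hδ
    have h0 : δ ⊆ (M.erase e).erase e' := Finset.mem_powerset.1 hδ
    have h1 : δ ⊆ M.erase e := h0.trans (Finset.erase_subset _ _)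
    refine ⟨h1, ?_, h1.trans (Finset.erase_subset _ _), fun h => heM' (h1 h), fun h => he'M'' (h0 h)⟩
    intro x hx
    have := h0 hx
    exact Finset.mem_erase.2 ⟨(Finset.mem_erase.1 this).1, Finset.mem_of_mem_erase (Finset.mem_erase.1 this).2⟩
  -- (1) values of the four generators on `Φ = f̂ĝ`
  have hvY : ∀ δ ∈ ((M.erase e).erase e').powerset, ∀ n ∈ (M \ S).erase e',
      Φ δ + Φ (S.erase e \ δ ∪ δ \ S.erase e) - Φ (insert n δ) - Φ (insert n (S.erase e \ δ ∪ δ \ S.erase e)) =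
        Φ δ + Φ (insert e (insert n δ)) - Φ (insert e δ) - Φ (insert n δ) := by
    intro δ hδ n hn
    obtain ⟨hδe, -, -, -, -⟩ := hsub δ hδ
    have hnN : n ∈ M \ S := Finset.mem_of_mem_erase hn
    have hnS : n ∉ S := (Finset.mem_sdiff.1 hnN).2
    have hne : n ≠ e := fun h => hnS (h ▸ he)
    have hnS' : n ∉ S.erase e := fun h => hnS (Finset.mem_of_mem_erase h)
    have hnδ : insert n δ ⊆ M.erase e := Finset.insert_subset (Finset.mem_erase.2 ⟨hne, (Finset.mem_sdiff.1 hnN).1⟩) hδe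
    have eq1 : Φ (S.erase e \ δ ∪ δ \ S.erase e) = -Φ (insert e δ) := by
      simp only [hΦ]; exact hat_prod_sflip_erase M C S f g hS he hf hg hδe
    have eq2 : Φ (insert n (S.erase e \ δ ∪ δ \ S.erase e)) = -Φ (insert e (insert n δ)) := by
      rw [insert_tflip_of_notMem hnS']; simp only [hΦ]; exact hat_prod_sflip_erase M C S f g hS he hf hg hnδ
    rw [eq1, eq2]; ring
  have hvX : ∀ δ ∈ ((M.erase e).erase e').powerset, ∀ a ∈ S.erase e,
      Φ δ + Φ ((M \ S).erase e' \ δ ∪ δ \ (M \ S).erase e') - Φ (insert a δ) -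
          Φ (insert a ((M \ S).erase e' \ δ ∪ δ \ (M \ S).erase e')) =
        Φ δ + Φ (insert a (insert e' δ)) - Φ (insert a δ) - Φ (insert e' δ) := by
    intro δ hδ a ha
    obtain ⟨-, hδe', -, -, -⟩ := hsub δ hδ
    have haS : a ∈ S := Finset.mem_of_mem_erase ha
    have hae' : a ≠ e' := fun h => he'S (h ▸ haS)
    have haN' : a ∉ (M \ S).erase e' := fun h => (Finset.mem_sdiff.1 (Finset.mem_of_mem_erase h)).2 haS
    have haδ : insert a δ ⊆ M.erase e' := Finset.insert_subset (Finset.mem_erase.2 ⟨hae', hS haS⟩) hδe'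
    have eq1 : Φ ((M \ S).erase e' \ δ ∪ δ \ (M \ S).erase e') = -Φ (insert e' δ) := by
      simp only [hΦ]; exact hat_prod_nflip_erase M C S f g hS he' hf hg hδe'
    have eq2 : Φ (insert a ((M \ S).erase e' \ δ ∪ δ \ (M \ S).erase e')) = -Φ (insert e' (insert a δ)) := by
      rw [insert_tflip_of_notMem haN']; simp only [hΦ]; exact hat_prod_nflip_erase M C S f g hS he' hf hg haδ
    rw [eq1, eq2, Finset.insert_comm e' a δ]; ring
  have hvK : ∀ δ ∈ ((M.erase e).erase e').powerset,
      Φ δ + Φ (S.erase e \ δ ∪ δ \ S.erase e) + Φ ((M \ S).erase e' \ δ ∪ δ \ (M \ S).erase e') +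
          Φ (((M.erase e).erase e') \ δ) =
        Φ δ + Φ (insert e (insert e' δ)) - Φ (insert e δ) - Φ (insert e' δ) := by
    intro δ hδ
    obtain ⟨hδe, hδe', hδM, -, -⟩ := hsub δ hδ
    have eq1 : Φ (S.erase e \ δ ∪ δ \ S.erase e) = -Φ (insert e δ) := by
      simp only [hΦ]; exact hat_prod_sflip_erase M C S f g hS he hf hg hδe
    have eq2 : Φ ((M \ S).erase e' \ δ ∪ δ \ (M \ S).erase e') = -Φ (insert e' δ) := by
      simp only [hΦ]; exact hat_prod_nflip_erase M C S f g hS he' hf hg hδe'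
    have hγ : insert e (insert e' δ) ⊆ M := Finset.insert_subset heM (Finset.insert_subset he'M hδM)
    have eq3 : Φ (((M.erase e).erase e') \ δ) = Φ (insert e (insert e' δ)) := by
      rw [← sdiff_insert_insert_eq]; simp only [hΦ]; exact hat_prod_sdiff M C f g hγ
    rw [eq1, eq2, eq3]; ring
  -- (2) the right-hand side of the certificate at `Φ` is nonnegative
  have hR : 0 ≤ ∑ δ ∈ ((M.erase e).erase e').powerset,
      (∑ a ∈ S.erase e, ∑ n ∈ (M \ S).erase e',
          c δ a n * (Φ δ + Φ (insert a (insert n δ)) - Φ (insert a δ) - Φ (insert n δ)) +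
        ∑ n ∈ (M \ S).erase e', dY δ n * (Φ δ + Φ (S.erase e \ δ ∪ δ \ S.erase e) - Φ (insert n δ) -
          Φ (insert n (S.erase e \ δ ∪ δ \ S.erase e))) +
        ∑ a ∈ S.erase e, dX δ a * (Φ δ + Φ ((M \ S).erase e' \ δ ∪ δ \ (M \ S).erase e') - Φ (insert a δ) -
          Φ (insert a ((M \ S).erase e' \ δ ∪ δ \ (M \ S).erase e'))) +
        κ δ * (Φ δ + Φ (S.erase e \ δ ∪ δ \ S.erase e) + Φ ((M \ S).erase e' \ δ ∪ δ \ (M \ S).erase e') +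
          Φ (((M.erase e).erase e') \ δ))) := by
    refine Finset.sum_nonneg fun δ hδ => add_nonneg (add_nonneg (add_nonneg
      (Finset.sum_nonneg fun a ha => Finset.sum_nonneg fun n hn => ?_) (Finset.sum_nonneg fun n hn => ?_))
      (Finset.sum_nonneg fun a ha => ?_)) ?_
    · refine mul_nonneg (hc δ a n) ?_
      have := square_hat_nonneg M C S f g (Finset.mem_of_mem_erase ha)
        (Finset.mem_sdiff.1 (Finset.mem_of_mem_erase hn)).2 hf hg hfm hgm δ
      simpa only [hΦ] using this
    · refine mul_nonneg (hdY δ n) ?_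
      rw [hvY δ hδ n hn]
      have := square_hat_nonneg M C S f g he (Finset.mem_sdiff.1 (Finset.mem_of_mem_erase hn)).2 hf hg hfm hgm δ
      simpa only [hΦ] using this
    · refine mul_nonneg (hdX δ a) ?_
      rw [hvX δ hδ a ha]
      have := square_hat_nonneg M C S f g (Finset.mem_of_mem_erase ha) he'S hf hg hfm hgm δ
      simpa only [hΦ] using this
    · refine mul_nonneg (hκ δ) ?_
      rw [hvK δ hδ]
      have := square_hat_nonneg M C S f g he he'S hf hg hfm hgm δ
      simpa only [hΦ] using this
  -- (3) the four slices of the levelwise sum, folded onto the quarter `δ ⊆ M''`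
  have hslice_e : ∑ δ ∈ ((M.erase e).erase e').powerset, (if apExpC M C (insert e δ) ≤ J then Φ (insert e δ) else 0) =
      -∑ δ ∈ ((M.erase e).erase e').powerset, (if apExpC M C (S \ δ ∪ δ \ S) ≤ J then Φ δ else 0) := by
    rw [← Finset.sum_neg_distrib]
    symm
    refine Finset.sum_nbij' (fun δ => S.erase e \ δ ∪ δ \ S.erase e) (fun δ => S.erase e \ δ ∪ δ \ S.erase e)
      (fun δ hδ => ?_) (fun δ hδ => ?_) (fun δ hδ => ?_) (fun δ hδ => ?_) (fun δ hδ => ?_)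
    · exact Finset.mem_powerset.2 (sflip_subset hS' (Finset.mem_powerset.1 hδ))
    · exact Finset.mem_powerset.2 (sflip_subset hS' (Finset.mem_powerset.1 hδ))
    · exact sflip_sflip hS' (Finset.mem_powerset.1 hδ)
    · exact sflip_sflip hS' (Finset.mem_powerset.1 hδ)
    · obtain ⟨-, -, hδM, heδ, -⟩ := hsub δ hδ
      rw [insert_sflip_erase he heδ]
      have hval : Φ (S \ δ ∪ δ \ S) = -Φ δ := by
        simp only [hΦ]
        rw [hat_sflip_of_readOnly (C := C) hS hδM hf, hat_sflip_of_notRead (C := C) hS hδM hg]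
        ring
      split_ifs <;> simp [hval]
  have hslice_e' : ∑ δ ∈ ((M.erase e).erase e').powerset, (if apExpC M C (insert e' δ) ≤ J then Φ (insert e' δ) else 0) =
      -∑ δ ∈ ((M.erase e).erase e').powerset, (if apExpC M C (S \ δ ∪ δ \ S) ≤ J then Φ δ else 0) := by
    rw [← Finset.sum_neg_distrib]
    symm
    refine Finset.sum_nbij' (fun δ => (M \ S).erase e' \ δ ∪ δ \ (M \ S).erase e')
      (fun δ => (M \ S).erase e' \ δ ∪ δ \ (M \ S).erase e')
      (fun δ hδ => ?_) (fun δ hδ => ?_) (fun δ hδ => ?_) (fun δ hδ => ?_) (fun δ hδ => ?_)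
    · exact Finset.mem_powerset.2 (sflip_subset hN' (Finset.mem_powerset.1 hδ))
    · exact Finset.mem_powerset.2 (sflip_subset hN' (Finset.mem_powerset.1 hδ))
    · exact sflip_sflip hN' (Finset.mem_powerset.1 hδ)
    · exact sflip_sflip hN' (Finset.mem_powerset.1 hδ)
    · obtain ⟨-, -, hδM, -, he'δ⟩ := hsub δ hδ
      rw [insert_sflip_erase he' he'δ]
      have hval : Φ ((M \ S) \ δ ∪ δ \ (M \ S)) = -Φ δ := by
        simp only [hΦ]
        rw [hat_nflip_of_readOnly (C := C) hS hδM hf, hat_nflip_of_notRead (C := C) hS hδM hg]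
        ring
      simp only [apExpC_nflip M C S δ hS hδM]
      split_ifs <;> simp [hval]
  have hslice_ee' : ∑ δ ∈ ((M.erase e).erase e').powerset,
      (if apExpC M C (insert e (insert e' δ)) ≤ J then Φ (insert e (insert e' δ)) else 0) =
      ∑ δ ∈ ((M.erase e).erase e').powerset, (if apExpC M C δ ≤ J then Φ δ else 0) := by
    symm
    refine Finset.sum_nbij' (fun δ => ((M.erase e).erase e') \ δ) (fun δ => ((M.erase e).erase e') \ δ)
      (fun δ hδ => ?_) (fun δ hδ => ?_) (fun δ hδ => ?_) (fun δ hδ => ?_) (fun δ hδ => ?_)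
    · exact Finset.mem_powerset.2 Finset.sdiff_subset
    · exact Finset.mem_powerset.2 Finset.sdiff_subset
    · exact Finset.sdiff_sdiff_eq_self (Finset.mem_powerset.1 hδ)
    · exact Finset.sdiff_sdiff_eq_self (Finset.mem_powerset.1 hδ)
    · obtain ⟨-, -, hδM, -, -⟩ := hsub δ hδ
      rw [insert_insert_sdiff_eq heM he'M (Finset.mem_powerset.1 hδ)]
      have hval : Φ (M \ δ) = Φ δ := by simp only [hΦ]; exact hat_prod_sdiff M C f g hδM
      simp only [apExpC_sdiff M C hδM, hval]
  -- (4) assemble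
  have hpow1 : M.powerset = (insert e (M.erase e)).powerset := by rw [Finset.insert_erase heM]
  have hpow2 : (M.erase e).powerset = (insert e' ((M.erase e).erase e')).powerset := by rw [Finset.insert_erase he'Me]
  rw [Finset.sum_filter, hpow1, Finset.sum_powerset_insert heM', hpow2, Finset.sum_powerset_insert he'M'',
    Finset.sum_powerset_insert he'M'']
  have key := hcert Φ
  rw [Finset.sum_sub_distrib] at key
  linarith [hR, hslice_e, hslice_e', hslice_ee']

end FK

end Summit.CriticalPhenomena.PercolationContinuityZ3.Theorems

end
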